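import Summits.NavierStokesRegularity.NavierStokesRegularity.Theorems.AxisymmetricExtremalityAxisymmetricKatoGlobalStubSeregin2020TypeIILemma22MoserEmbed
import Summits.NavierStokesRegularity.NavierStokesRegularity.Theorems.AxisTwistDoorAveragedConeLiouvilleNUMoserEmbedding
import HarnessLib

/-!
# Nazarov–Uraltseva 2011, Cor. 3.2 (propagation of positivity, N4 of cell pub/ns-inputs), piece P1 = N-M1
# (the AXIS-FREE Moser step) — the reverse-Hölder core (embedding + Hölder (3,2,6) on the drift + absorption)

Axis-free TWIN of the A1 file `…Lemma22MoserEmbed` (seat wu-p33, Seregin 2020 Lemma 2.2 ⇐ N–U 2012 Lemma 3.1): the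
energy-class hypothesis `hEC` is the A1 text with the axis integral `∫∫ η (2/ϱ) H(Φ) ∂_{e_r}(Θ²)` DELETED
(= `NUEnergyClass` of `…NUDefs`, the class of a non-negative supersolution of `∂ₜV − ΔV + b·∇V = 0` with a drift in
the A1 drift class; N–U 2011 §3 has no axis term); statements and proofs otherwise verbatim, theorem names prefixed
`nu_`, the generic helpers of the A1 file used BY NAME.  Width seat ns-in-wu-341 g2 (director-ns
inputs-23; plan g6 N4 cut, piece P1).

## References

* A. I. Nazarov, N. N. Uraltseva, Algebra i Analiz 23:1 (2011) = St. Petersburg Math. J. 23 (2012) 93–115 =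
  arXiv:1011.1888, §3, Lemma 3.1, (3.2)–(3.6), Remarks 5, 9. [NazarovUraltseva2011HarnackDivFree] [NazarovUraltseva2012]
* Z. Lei, X. Ren, G. Tian, arXiv:2501.08976, Lemma 2.5. [LeiRenTian2025]

WHAT THIS IS NOT: not a statement about Navier–Stokes regularity; one brick of the discharge of the NAMED fact
`NazarovUraltseva2011_positivity_propagation` (INPUT N4); nothing is closed by this file.
-/

-- the problem directory repeats the summit name (D-0017); core's `dupNamespace` linter fires
set_option linter.dupNamespace false

noncomputable section

open MeasureTheory Set Function Filter Topology Metric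
open scoped NNReal ENNReal RealInnerProductSpace

namespace Summit.NavierStokesRegularity.NavierStokesRegularity.Theorems.AveragedConeLiouville.NU

open Literature.Analysis.FluidPDE Literature.Analysis.FluidPDE.LeiZhang2011
open Summit.NavierStokesRegularity.NavierStokesRegularity.Theorems.AxisymmetricKatoGlobal.EulerScaling

/-- **The reverse-Hölder core of the Moser step (N–U (3.3)–(3.6) for one exponent).** Data as in
`moser_energy_bounds` plus the `C¹` slices for a.e. `t ∈ ]-R²,0[` and the a.e.-strong
measurability of `U`; conclusion: with `w = η^{1/2} (l-Φ)₊^{q/2} φ³`,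
`T = ∫∫_{]t₁,t₀[×ℝ³} w^{10/3} ≤ (2 C₁ (36L_φ² + B_η) I₁ + 2^{12}·729·C₁⁶ L_φ⁶ ‖U‖³_{L³(Q₁)}² I₁)^{5/3}`,
`C₁ = (3 C_S²)^{3/5}`, `C_S = SNormLESNormFDerivOfEqConst ℝ volume 2`, `I₁ = ∫∫_{Q₁} (l-Φ)₊^q`,
`Q₁ = ]t₁,t₀[ × B̄(0,ρ₁)` (embedding `𝒱 ⊂ L^{10/3}`, Hölder `(3,2,6)` on the drift majorant,
absorption). [cite: NazarovUraltseva2012, proof of Lemma 3.1, (3.3)–(3.6), Remarks 5, 6, 9] -/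
theorem nu_moser_reverse_holder_core
    (Φ : ℝ → EuclideanSpace ℝ (Fin 3) → ℝ)
    (U : ℝ → EuclideanSpace ℝ (Fin 3) → EuclideanSpace ℝ (Fin 3)) (k R : ℝ)
    (hΦm : Measurable (uncurry Φ)) (hΦ0 : ∀ t x, 0 ≤ Φ t x)
    (hC1 : ∀ᵐ t : ℝ, t ∈ Ioo (-R ^ 2) 0 → ContDiff ℝ 1 (Φ t))
    (hU : AEStronglyMeasurable (uncurry U) volume)
    (hEC : ∀ (H : ℝ → ℝ), ContDiff ℝ 2 H → (∀ v, deriv H v ≤ 0) → (∀ v, 0 ≤ H v) →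
      (∀ v, 0 ≤ deriv (deriv H) v) → (∀ v, deriv H v ^ 2 ≤ 2 * H v * deriv (deriv H) v) →
      (∀ v, k ≤ v → H v = 0) →
      ∀ (Θ : EuclideanSpace ℝ (Fin 3) → ℝ), ContDiff ℝ 1 Θ → HasCompactSupport Θ →
        tsupport Θ ⊆ ball (0 : EuclideanSpace ℝ (Fin 3)) (2 * R) →
      ∀ (η : ℝ → ℝ), ContDiff ℝ 1 η → (∀ s, 0 ≤ η s) →
      ∀ (t₁ t₂ : ℝ), -R ^ 2 < t₁ → t₁ ≤ t₂ → t₂ < 0 →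
        ENNReal.ofReal (η t₂ * ∫ x, H (Φ t₂ x) * Θ x ^ 2) +
          ∫⁻ z in Icc t₁ t₂ ×ˢ (univ : Set (EuclideanSpace ℝ (Fin 3))), ENNReal.ofReal
            (1 / 2 * η z.1 * (deriv (deriv H) (Φ z.1 z.2) * ‖gradient (Φ z.1) z.2‖ ^ 2 *
              Θ z.2 ^ 2))
        ≤ ENNReal.ofReal (η t₁ * (∫ x, H (Φ t₁ x) * Θ x ^ 2) +
            (4 * ∫ z in Icc t₁ t₂ ×ˢ (univ : Set (EuclideanSpace ℝ (Fin 3))),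
              η z.1 * (H (Φ z.1 z.2) * ‖gradient Θ z.2‖ ^ 2)) +
            (∫ z in Icc t₁ t₂ ×ˢ (univ : Set (EuclideanSpace ℝ (Fin 3))),
              η z.1 * (H (Φ z.1 z.2) * inner ℝ (U z.1 z.2) (gradient (fun y => Θ y ^ 2) z.2))) +
            (∫ z in Icc t₁ t₂ ×ˢ (univ : Set (EuclideanSpace ℝ (Fin 3))),
              |deriv η z.1| * (H (Φ z.1 z.2) * Θ z.2 ^ 2))))
    {ρ₂ ρ₁ t₁ t₀ l q Lφ Bη : ℝ} (hρ₂ : 0 < ρ₂) (hρ₁ : ρ₂ < ρ₁) (hρ₁R : ρ₁ < 2 * R)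
    (ht₁ : -R ^ 2 < t₁) (ht : t₁ < t₀) (ht₀ : t₀ ≤ 0) (hl : 0 < l) (hlk : l ≤ k) (hq : 2 < q)
    {φ : EuclideanSpace ℝ (Fin 3) → ℝ} (hφdef : φ = radialCutoff ρ₂ ρ₁)
    (hLφ : ∀ x, ‖fderiv ℝ φ x‖ ≤ Lφ)
    {η : ℝ → ℝ} (hη : ContDiff ℝ 1 η) (hη01 : ∀ s, 0 ≤ η s ∧ η s ≤ 1) (hBη0 : 0 ≤ Bη)
    (hBη : ∀ s, |deriv η s| ≤ Bη)
    (hinit : η t₁ * (∫ x, max (l - Φ t₁ x) 0 ^ q * (φ x ^ 3) ^ 2) = 0) :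
    ∫⁻ z in Ioo t₁ t₀ ×ˢ (univ : Set (EuclideanSpace ℝ (Fin 3))),
        ENNReal.ofReal ((η z.1 ^ ((1 : ℝ) / 2) * max (l - Φ z.1 z.2) 0 ^ (q / 2) * φ z.2 ^ 3) ^
          ((10 : ℝ) / 3)) ≤
      (2 * ((3 * (SNormLESNormFDerivOfEqConst ℝ (volume : Measure (EuclideanSpace ℝ (Fin 3))) 2
              : ℝ≥0∞) ^ 2) ^ ((3 : ℝ) / 5)) *
          (ENNReal.ofReal (36 * Lφ ^ 2 + Bη) *
            ∫⁻ z in Ioo t₁ t₀ ×ˢ closedBall (0 : EuclideanSpace ℝ (Fin 3)) ρ₁,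
              ENNReal.ofReal (max (l - Φ z.1 z.2) 0 ^ q)) +
        (2 * ((3 * (SNormLESNormFDerivOfEqConst ℝ (volume : Measure (EuclideanSpace ℝ (Fin 3))) 2
              : ℝ≥0∞) ^ 2) ^ ((3 : ℝ) / 5)) *
            ((8 * ∫⁻ z in Ioo t₁ t₀ ×ˢ closedBall (0 : EuclideanSpace ℝ (Fin 3)) ρ₁,
                ‖U z.1 z.2‖ₑ ^ (3 : ℕ)) ^ ((1 : ℝ) / 3) *
              (ENNReal.ofReal (729 * Lφ ^ 6) *
                ∫⁻ z in Ioo t₁ t₀ ×ˢ closedBall (0 : EuclideanSpace ℝ (Fin 3)) ρ₁,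
                  ENNReal.ofReal (max (l - Φ z.1 z.2) 0 ^ q)) ^ ((1 : ℝ) / 6))) ^ (6 : ℕ)) ^
        ((5 : ℝ) / 3) := by
  ----------------------------------------------------------------
  -- notation
  ----------------------------------------------------------------
  set CS : ℝ≥0∞ := (SNormLESNormFDerivOfEqConst ℝ (volume : Measure (EuclideanSpace ℝ (Fin 3))) 2
    : ℝ≥0∞) with hCS
  set C₁ : ℝ≥0∞ := (3 * CS ^ 2) ^ ((3 : ℝ) / 5) with hC₁
  set K : Set (EuclideanSpace ℝ (Fin 3)) := closedBall (0 : EuclideanSpace ℝ (Fin 3)) ρ₁ with hK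
  have hKm : MeasurableSet K := measurableSet_closedBall
  set Q₁ : Set (ℝ × EuclideanSpace ℝ (Fin 3)) := Ioo t₁ t₀ ×ˢ K with hQ₁
  have hQ₁m : MeasurableSet Q₁ := measurableSet_Ioo.prod hKm
  set Qu : Set (ℝ × EuclideanSpace ℝ (Fin 3)) := Ioo t₁ t₀ ×ˢ (univ : Set (EuclideanSpace ℝ (Fin 3)))
    with hQu
  set V : ℝ × EuclideanSpace ℝ (Fin 3) → ℝ := fun z => max (l - Φ z.1 z.2) 0 with hV
  have hV0 : ∀ z, 0 ≤ V z := fun z => le_max_right _ _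
  have hVm : Measurable V := (measurable_const.sub hΦm).max measurable_const
  have hVl : ∀ z, V z ≤ l := fun z => max_le (by linarith [hΦ0 z.1 z.2]) hl.le
  set w : ℝ × EuclideanSpace ℝ (Fin 3) → ℝ := fun z =>
    η z.1 ^ ((1 : ℝ) / 2) * V z ^ (q / 2) * φ z.2 ^ 3 with hw
  set g : ℝ × EuclideanSpace ℝ (Fin 3) → ℝ := fun z =>
    3 * (η z.1 ^ ((1 : ℝ) / 6) * V z ^ (q / 6)) * ‖fderiv ℝ φ z.2‖ with hg
  set I₁ : ℝ≥0∞ := ∫⁻ z in Q₁, ENNReal.ofReal (V z ^ q) with hI₁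
  set U₃ : ℝ≥0∞ := ∫⁻ z in Q₁, ‖U z.1 z.2‖ₑ ^ (3 : ℕ) with hU₃
  set E₀ : ℝ≥0∞ := ENNReal.ofReal (36 * Lφ ^ 2 + Bη) * I₁ with hE₀
  set DR : ℝ≥0∞ := ∫⁻ z in Q₁, ENNReal.ofReal (6 * (η z.1 * V z ^ q) * φ z.2 ^ 5 *
    ‖U z.1 z.2‖ * ‖fderiv ℝ φ z.2‖) with hDR
  set E : ℝ≥0∞ := E₀ + DR with hE
  set T : ℝ≥0∞ := ∫⁻ z in Qu, ENNReal.ofReal (w z ^ ((10 : ℝ) / 3)) with hT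
  set G : ℝ≥0∞ := (ENNReal.ofReal (729 * Lφ ^ 6) * I₁) ^ ((1 : ℝ) / 6) with hG
  -- cut-off facts
  obtain ⟨hΘ1, hΘc, hΘK, hφ01, -, -, -, -⟩ := moserTheta_props hρ₂.le hρ₁ hφdef
  have hφs : ContDiff ℝ 1 φ := by rw [hφdef]; exact radialCutoff_contDiff ρ₂ ρ₁
  have hφc : Continuous φ := hφs.continuous
  have hφK : ∀ x, x ∉ K → φ x = 0 := fun x hx => by
    rw [hφdef]
    exact radialCutoff_eq_zero hρ₂.le hρ₁ (le_of_lt (by simpa [hK, mem_closedBall_zero_iff] using hx))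
  have hη0 : ∀ s, 0 ≤ η s := fun s => (hη01 s).1
  have hη1 : ∀ s, η s ≤ 1 := fun s => (hη01 s).2
  have hw0 : ∀ z, 0 ≤ w z := fun z =>
    mul_nonneg (mul_nonneg (Real.rpow_nonneg (hη0 _) _) (Real.rpow_nonneg (hV0 z) _))
      (pow_nonneg (hφ01 _).1 3)
  have hg0 : ∀ z, 0 ≤ g z := fun z => by
    simp only [hg]
    exact mul_nonneg (mul_nonneg (by norm_num) (mul_nonneg (Real.rpow_nonneg (hη0 _) _)
      (Real.rpow_nonneg (hV0 z) _))) (norm_nonneg _)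
  -- measurability
  have hηm : Measurable η := hη.continuous.measurable
  have hwm : Measurable w :=
    (((hηm.comp measurable_fst).pow_const _).mul (hVm.pow_const _)).mul
      ((hφc.measurable.comp measurable_snd).pow_const _)
  have hDφm : Measurable fun z : ℝ × EuclideanSpace ℝ (Fin 3) => ‖fderiv ℝ φ z.2‖ :=
    ((hφs.continuous_fderiv one_ne_zero).norm.measurable.comp measurable_snd)
  have hgm : Measurable g :=
    (measurable_const.mul (((hηm.comp measurable_fst).pow_const _).mul (hVm.pow_const _))).mul hDφm
  have hUm : AEStronglyMeasurable (fun z : ℝ × EuclideanSpace ℝ (Fin 3) => U z.1 z.2) volume := hU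
  ----------------------------------------------------------------
  -- Step 0: the energy bounds
  ----------------------------------------------------------------
  obtain ⟨hslice, hdiss⟩ := nu_moser_energy_bounds Φ U k R hΦm hΦ0 hEC hρ₂ hρ₁ hρ₁R ht₁ ht ht₀ hl hlk
    hq hφdef hLφ hη hη01 hBη0 hBη hinit
  obtain ⟨hTfin, hT_le⟩ := nu_moser_embedding_estimate Φ U k R hΦm hΦ0 hC1 hU hEC hρ₂ hρ₁ hρ₁R ht₁
    ht ht₀ hl hlk hq hφdef hLφ hη hη01 hBη0 hBη hinit
  ----------------------------------------------------------------
  -- Step 3: Hölder `(3, 2, 6)` for the drift majorant: `DR ≤ (8U₃)^{1/3} T^{1/2} G`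
  ----------------------------------------------------------------
  have hDR : DR ≤ (8 * U₃) ^ ((1 : ℝ) / 3) * T ^ ((1 : ℝ) / 2) * G := by
    set f₁ : ℝ × EuclideanSpace ℝ (Fin 3) → ℝ≥0∞ := fun z => ENNReal.ofReal (2 * ‖U z.1 z.2‖) ^ (3 : ℕ)
      with hf₁
    set f₂ : ℝ × EuclideanSpace ℝ (Fin 3) → ℝ≥0∞ := fun z => ENNReal.ofReal (w z ^ ((10 : ℝ) / 3))
      with hf₂
    set f₃ : ℝ × EuclideanSpace ℝ (Fin 3) → ℝ≥0∞ := fun z => ENNReal.ofReal (g z) ^ (6 : ℕ) with hf₃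
    have hf₁m : AEMeasurable f₁ (volume.restrict Q₁) :=
      ((hUm.norm.aemeasurable.const_mul 2).ennreal_ofReal.pow_const _).restrict
    have hf₂m : AEMeasurable f₂ (volume.restrict Q₁) :=
      ((hwm.pow_const _).ennreal_ofReal).aemeasurable
    have hf₃m : AEMeasurable f₃ (volume.restrict Q₁) :=
      (hgm.ennreal_ofReal.pow_const _).aemeasurable
    -- pointwise splitting
    have hpt : ∀ z, ENNReal.ofReal (6 * (η z.1 * V z ^ q) * φ z.2 ^ 5 * ‖U z.1 z.2‖ *
        ‖fderiv ℝ φ z.2‖) = f₁ z ^ ((1 : ℝ) / 3) * f₂ z ^ ((1 : ℝ) / 2) * f₃ z ^ ((1 : ℝ) / 6) := by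
      intro z
      have hsplit := drift_split_rpow (q := q) (a := ‖U z.1 z.2‖) (b := ‖fderiv ℝ φ z.2‖)
        (hη0 z.1) (hV0 z) (hφ01 z.2).1
      rw [hsplit]
      have e1 : f₁ z ^ ((1 : ℝ) / 3) = ENNReal.ofReal (2 * ‖U z.1 z.2‖) := by
        rw [hf₁]; dsimp only
        rw [← ENNReal.rpow_natCast, ← ENNReal.rpow_mul]; norm_num
      have e2 : f₂ z ^ ((1 : ℝ) / 2) = ENNReal.ofReal (w z ^ ((5 : ℝ) / 3)) := by
        rw [hf₂]; dsimp only
        rw [ENNReal.ofReal_rpow_of_nonneg (Real.rpow_nonneg (hw0 z) _) (by norm_num),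
          ← Real.rpow_mul (hw0 z)]
        norm_num
      have e3 : f₃ z ^ ((1 : ℝ) / 6) = ENNReal.ofReal (g z) := by
        rw [hf₃]; dsimp only
        rw [← ENNReal.rpow_natCast, ← ENNReal.rpow_mul]; norm_num
      rw [e1, e2, e3, ← ENNReal.ofReal_mul (by positivity),
        ← ENNReal.ofReal_mul (mul_nonneg (by positivity) (Real.rpow_nonneg (hw0 z) _))]
    have hDR' : DR = ∫⁻ z in Q₁, f₁ z ^ ((1 : ℝ) / 3) * f₂ z ^ ((1 : ℝ) / 2) * f₃ z ^ ((1 : ℝ) / 6) :=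
      lintegral_congr fun z => hpt z
    rw [hDR']
    refine (lintegral_rpow_third_half_sixth_le hf₁m hf₂m hf₃m).trans ?_
    -- the three integrals
    have hI1 : ∫⁻ z in Q₁, f₁ z = 8 * U₃ := by
      have e : ∀ z, f₁ z = 8 * ‖U z.1 z.2‖ₑ ^ (3 : ℕ) := fun z => by
        rw [hf₁]; dsimp only
        rw [ENNReal.ofReal_mul (by norm_num), ENNReal.ofReal_ofNat, ofReal_norm, mul_pow]
        norm_num
      rw [lintegral_congr fun z => e z, lintegral_const_mul' _ _ (by norm_num)]
    have hI2 : ∫⁻ z in Q₁, f₂ z ≤ T :=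
      lintegral_mono_set (prod_mono le_rfl (subset_univ _))
    have hI3 : ∫⁻ z in Q₁, f₃ z ≤ ENNReal.ofReal (729 * Lφ ^ 6) * I₁ := by
      rw [hI₁, ← lintegral_const_mul' _ _ ENNReal.ofReal_ne_top]
      refine lintegral_mono fun z => ?_
      rw [hf₃]; dsimp only
      rw [← ENNReal.ofReal_pow (hg0 z), ← ENNReal.ofReal_mul (by positivity)]
      refine ENNReal.ofReal_le_ofReal ?_
      have hg6 := pow_six_g_rpow (q := q) (b := ‖fderiv ℝ φ z.2‖) (hη0 z.1) (hV0 z)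
      simp only [hg]
      rw [hg6]
      have hD6 : ‖fderiv ℝ φ z.2‖ ^ 6 ≤ Lφ ^ 6 := pow_le_pow_left₀ (norm_nonneg _) (hLφ _) 6
      calc 729 * (η z.1 * V z ^ q) * ‖fderiv ℝ φ z.2‖ ^ 6 ≤ 729 * (1 * V z ^ q) * Lφ ^ 6 := by
            gcongr
            exact hη1 _
        _ = 729 * Lφ ^ 6 * V z ^ q := by ring
    rw [hI1, hG]
    gcongr
  ----------------------------------------------------------------
  -- Step 4: absorption with `y = T^{1/10}`
  ----------------------------------------------------------------
  set y : ℝ≥0∞ := T ^ ((1 : ℝ) / 10) with hy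
  obtain ⟨hy6, hy5, hy10⟩ := rpow_tenth_powers T
  have hyfin : y ≠ ∞ := ENNReal.rpow_ne_top_of_nonneg (by norm_num) hTfin
  have hy6_le : y ^ 6 ≤ C₁ * E := by
    rw [hy6]
    calc T ^ ((3 : ℝ) / 5) ≤ (3 * CS ^ 2 * E ^ ((5 : ℝ) / 3)) ^ ((3 : ℝ) / 5) :=
          ENNReal.rpow_le_rpow hT_le (by norm_num)
      _ = C₁ * E := by
          rw [ENNReal.mul_rpow_of_nonneg _ _ (by norm_num : (0 : ℝ) ≤ 3 / 5), ← ENNReal.rpow_mul]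
          norm_num
          rw [hC₁]
  have hkey : y ^ 6 ≤ C₁ * E₀ + (C₁ * ((8 * U₃) ^ ((1 : ℝ) / 3) * G)) * y ^ 5 := by
    rw [hy5]
    calc y ^ 6 ≤ C₁ * E := hy6_le
      _ = C₁ * E₀ + C₁ * DR := by rw [hE, mul_add]
      _ ≤ C₁ * E₀ + C₁ * ((8 * U₃) ^ ((1 : ℝ) / 3) * T ^ ((1 : ℝ) / 2) * G) := by gcongr
      _ = C₁ * E₀ + (C₁ * ((8 * U₃) ^ ((1 : ℝ) / 3) * G)) * T ^ ((1 : ℝ) / 2) := by ring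
  have habs := pow_six_le_of_le_add_mul_pow_five hyfin hkey
  -- `T = (y⁶)^{5/3}`
  calc T = (y ^ 6) ^ ((5 : ℝ) / 3) := hy10.symm
    _ ≤ (2 * (C₁ * E₀) + (2 * (C₁ * ((8 * U₃) ^ ((1 : ℝ) / 3) * G))) ^ 6) ^ ((5 : ℝ) / 3) :=
        ENNReal.rpow_le_rpow habs (by norm_num)
    _ = _ := by congr 1; ring


end Summit.NavierStokesRegularity.NavierStokesRegularity.Theorems.AveragedConeLiouville.NU

end
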